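import Mathlib.Data.List.Basic
import Mathlib.Data.Nat.Notation
import HarnessLib

/-!
# Venture HSemireg — the g = 6 OBJECT CENSUS (n = 3) of record as KERNEL DATA: one record per row of
# `target-g6/CENSUS.md` §2 (custodian t-16), for the signed § V-1 ∕ V-2 «NO-in-families-tried» (file `CensusG6Verdict.lean`)

HONEST FRAMING. Data file of a COMPUTATION cell (`pub-hsemireg`, Sunday typer seat p11, successor generation; the g = 8 twin is
p9's `CensusG8Table.lean`, whose schema this file follows field for field, plus two g = 6 fields). It TRANSCRIBES a census TABLE
of OBJECTS AND DESIGNS that the cell built and screened at named CM anchors of Weil-type abelian SIXFOLDS — it does not construct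
any variety, sheaf, cycle, cohomology group or semiregularity map, and no number in the census is recomputed here. What the kernel
checks (in `CensusG6Verdict.lean`) is BOOKKEEPING about this table: counts, buckets, and the coordinator's three-outcome form as a
FUNCTION of the table, evaluated on the DECIDING rows (the NON-SPLIT g = 6 components). Every cell below is the census custodian's ∕
row author's word, read by p11 from the file of record; the reading is published cell by cell, with the census excerpts it was read
from, in `run/shared/lean/pub/pub-hsemireg/p11/CENSUS-G6-LEAN-MAP.tsv` for the numbers referee. NOTHING HERE SAYS THAT HC, HC_CM
OR HC_AV IS PROVED OR REFUTED; «candidate» would be the strongest pre-referee word and no row carries it.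

SOURCE OF RECORD. `run/shared/lean/pub/pub-hsemireg/target-g6/CENSUS.md` **v3.77, sha256/16 `5d64c8087faa95c9`** (656 lines; §2 =
219 table rows), the post-sign successor of the census the SIGNED verdict prints (`target-g6/VERDICT-G6.md` v1.0
`1651dcc7322662a2`, § V-2: CENSUS **v3.75 `9ce5a28eeae1edae`, 218 rows = A 59 · B 45 · C 47 · D 43 (D 39 + D-L 4) · K 22 · L 2**,
re-parsed ×2 across referee seats; «non-split SEMIREG ∧ CLASS-OK 0; 0 YES verdict rows (38 SEMIREG+CLASS-worded cells all split ∕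
g = 4-in-print ∕ control ∕ negative; the 9 deciding cells with a YES token UNDECIDED ∕ component ∕ conditional); candidates 0»).
v3.76 ∕ v3.77 = the signed pin + ONE post-signing author row **C14-16** (t-14 g8; PROPOSITION K, structure ∕ negative row, no object,
«0 counted»; C 47 → 48, 218 → 219) + cell folds and §0 records — no other count change (custodian §3; referee re-parses ref g31 ∕
ref-4 g16 «219 = 218 + C14-16»). The field `signed` marks the 218 rows of the signed pin (`false` only for C14-16). Row extraction
follows the numbers referee's parser of record (`referee/ref4/census_parse_ref4.py`: table lines `| <id> | …` with ≥ 10 cells whose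
id starts with a capital letter; family = leading `K ∣ D-L ∣ D ∣ A ∣ B ∣ C ∣ L`), re-run by p11 on v3.77: 219 rows, 14 cells each,
A 59 · B 45 · C 48 · D 39 · D-L 4 · L 2 · K 22; 38 ∕ 9 flagged cells as signed.

SCHEMA (one `Row` per §2 table line; census columns c1 id · c3 CM point ∕ component · c4 type · c5 CLASS · c6 SEMIREGULARITY ·
c7 fails at · c8 vacuity · c10 verdict · c11 deciding?):
* `id` (c1 verbatim) · `family` (§0 «Families»: A = Φ(I_p ⊠ I_q ⊠ I_r) and its Φ-words ∕ twists ∕ towers, B = twisted Poincaré ∕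
  determinant-twist designs, C = class-C analogues transported from g = 4 (Künneth boxes, skeleton ∕ curve ideals, ∣2Θ∣ members,
  theta members by Weil field), D = objects of record before the 11:21Z scale-up (theta-secant, Markman control, C9 flat lci unions,
  line-bundle designs, cycles, simple CM anchors, Porteous loci, …), DL = the ladder rows D-L1…4 (eightfold ∕ tenfold objects that
  would decide all sixfolds), L = lattice-first widening questions, K = engine calibration rows) · `signed` (row of the signed pin
  v3.75) · `n` = the level the row's statement is about (`g = 2n`; 3 = a g = 6 statement; 1, 2, 4, 5, 6 = calibration ∕ ladder ∕
  rung rows carried by the g = 6 census; **0 = a statement for several or all levels** — n-tables, uniform-in-n laws, the (4, 5)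
  ladder pair D-L2) · `component` = the kind of Weil component (3, K, a) the row's verdict is READ ON (c3 with c11): `nonsplit` = at
  least one NON-SPLIT component (a ∉ Nm K^×: R1 = (3, ℚ(√−3), a ≡ 2), R2 = (…, a = 5), R3 = (3, ℚ(i), [3]), a = 10 ∕ 11, ℚ(i) a = 7,
  (3, ℚ(√−7), 3), …) — the DECIDING territory («DECIDING ⇔ a ∉ Nm K^×», R-59 (b)); `split` = split components only (a ∈ Nm K^×:
  METHOD-INSTANCE territory, in print modulo [Mar25 1.5.1] ∕ [Sch88]); `any` = a statement over EVERY component, split and non-split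
  (family-level theorems); `none` = no sixfold Weil component attaches (g ≠ 6 calibrations, a rational ∕ degenerate secant class,
  a 12-fold object, an empty anchor) · `kind`: `member` = a constructed object (or explicit finite family of objects) with its own
  class ∕ σ cells; `structureRow` = theorem ∕ law ∕ no-go ∕ design-cell ∕ named-open-problem ∕ door ∕ pointer rows (no single
  constructed object, or a statement about a whole class of objects — «negative rows are rows»); `calibration` = the K rows, the
  B11-cal rows, control duplicates (B11-8 = D-1) and the CTRL catalogue D-27; `barrierAllObjects` = an ALL-OBJECT barrier on a
  non-split g = 6 component (the «STRUCTURAL-NO» trigger) — NO ROW OF RECORD HAS THIS KIND («STRUCTURAL-NO NOT CLAIMED», V-1).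
* `cls` (c5 with c7): `ok` = CLASS-EXACT ∧ W-ALIVE (ch_k ∈ ℚh^k for k ≠ 3, ch₃ ∈ ℚh³ ⊕ W_K with W-part ≠ 0 — for twisted members
  Markman's κ; for structure rows: such classes exist in the row's scope) · `dead` = CLASS-DEAD (w = 0, junk ≠ 0, K-mismatch, sterile
  universe) · `undecided` · `none` (no class cell ∕ not a class statement).
* `sigma` (c6 with c7): `injective` = SEMIREG (σ resp. Bloch's π injective, incl. «in the model» and G-invariant doors) · `obstructed`
  = NOT-SEMIREG ∕ OBSTRUCTED (kernel > 0 exact, a count ∕ window ∕ squeeze ∕ E₂-budget argument, or a theorem closing the row's scope: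
  THEOREM V ∕ T5-23 for the h-free family-B laws per their WORDS OF RECORD) · `undecided` (σ-UNDECIDED: not computed ∕ out of engine
  range ∕ E₂-obstructed «one-way» only) · `none` (no σ number: class-dead rows that need none, class-level rows, no object).
  READING RULE for rows that list several members with different fates (e.g. C13-12: «−72, −264 CLASS-LIVE ∧ NOT-SEMIREG; −364 SEMIREG
  ∧ CLASS-LIVE split ⇒ METHOD INSTANCE»; B12-13: three alive + three window-dead): the cells record the member that gets FURTHEST
  (conservative for a negative statement) — named in the map.
* `verdict` (c10 by its leading token, read together with any «WORDS OF RECORD ∕ SUPERSEDING WORDS» clause the cell carries; §0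
  VERDICT VOCABULARY): `semiregClass` = SEMIREG+CLASS ∕ «SEMIREG(ULAR) ∧ CLASS-LIVE ⇒ METHOD INSTANCE» (on a non-split component it
  would be a CANDIDATE — no row) · `semiregClassDead` = SEMIREG ∕ CLASS-DEAD (MISSES-CLASS, red-6 F-3; either order of the two
  tokens) · `classOkNotSemireg` = CLASS-OK ∕ NOT-SEMIREG (incl. WINDOW-DEAD, and the family-B h-free laws whose head «σ-UNDECIDED» is
  superseded by the words of record «NOT-SEMIREG by THEOREM V ∕ T5-23 route 1») · `notSemireg` = NOT-SEMIREG ∕ FAIL (immobile) ∕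
  NO-IN-DESIGN ∕ LEMMA-DEAD (class half not decided or not worded) · `classDead` = CLASS-DEAD (incl. «CLASS-DEAD · NOT-SEMIREG»,
  NEGATIVE rows failing at CLASS) · `noObject` = NO MEMBER ∕ EMPTY ∕ NOT-AN-OBJECT ∕ NOT-LCI ∕ NONE FOUND ∕ input-not-an-object ·
  `openOrUndecided` = UNDECIDED ∕ OPEN ∕ LIVE DOOR ∕ named open problem or design cell · `structural` = STRUCTURE ∕ NEGATIVE ∕
  THEOREM ∕ NO DOOR ∕ STRUCTURAL SENTENCE ∕ CLOSED-BY-COUNT rows · `calibration` = CALIBRATION ∕ CONTROL · `pointer` = POINTER → other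
  rows ∕ MERGED into ∕ superseded by (no verdict of its own).
* `scWord` = the verdict cell c10 carries the token «SEMIREG+CLASS» or «CANDIDATE» — the numbers referee's REGEX of record
  (`SEMIREG\s*\+\s*CLASS|CANDIDATE`, case-insensitive): the signed «38 SEMIREG+CLASS-worded cells» (a SYNTACTIC flag: it also fires on
  «never a candidate», «not a CANDIDATE», «candidate NEGATIVE #k»). `yesToken` = the deciding cell c11 carries a bare «YES» by the
  referee's rule (`\bYES\b` and not «no (split) ∣ YES if ∣ would be ∣ ladder»): the signed «9 deciding cells with a YES token».
The multiplicities («×k codes ∕ seats») of the cells are NOT transcribed: no DECIDING row is SEMIREG ∧ CLASS at ANY multiplicity, so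
the YES-bar (class ×2 + σ ×2 on a named non-split component, A5 ∕ ref-4 RISK-1) is never reached.

References: the cell files named above (hash-pinned); [Bloch1972Semiregularity] S. Bloch, Invent. Math. 17 (1972) §1;
[BuchweitzFlenner2003] R.-O. Buchweitz, H. Flenner, Compositio Math. 137 (2003) (8.1) — for what «semiregular» means in the
census (the map whose injectivity the engines decide); [Mar25] E. Markman, arXiv:2502.03415 (preprint) and [Sch88] C. Schoen,
Compositio Math. 65 (1988) — the printed home of the SPLIT method instances; nothing of these papers is used or restated here.
-/

namespace Summit.Ventures.HSemireg.CensusG6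

/-- Object family of a CENSUS (g = 6) row (§0 «Families»; the family letter(s) leading the row id, as in the custodian's and the
numbers referee's parsers; `DL` = the ladder rows D-L1…4). [bookkeeping] -/
inductive Family | A | B | C | D | DL | L | K
  deriving DecidableEq, Repr

/-- The kind of Weil component (3, K, a) a row's verdict is read on: a NON-SPLIT one (deciding territory), SPLIT ones only
(method-instance territory, in print), EVERY component (family-level theorem rows), or none. [bookkeeping] -/
inductive Component | nonsplit | split | any | none
  deriving DecidableEq, Repr

/-- What a row IS: a constructed object (`member`), a structure ∕ theorem ∕ no-go ∕ design ∕ door ∕ pointer row (`structureRow`), a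
calibration ∕ control row (`calibration`), or an ALL-OBJECT barrier on a non-split g = 6 component (`barrierAllObjects`, the
«STRUCTURAL-NO» trigger — no row of record). [bookkeeping] -/
inductive Kind | member | structureRow | calibration | barrierAllObjects
  deriving DecidableEq, Repr

/-- The CLASS half of a row (census column c5 read with c7). [bookkeeping] -/
inductive ClassCell | ok | dead | undecided | none
  deriving DecidableEq, Repr

/-- The SEMIREGULARITY half of a row (census column c6 read with c7). [bookkeeping] -/
inductive SigmaCell | injective | obstructed | undecided | none
  deriving DecidableEq, Repr

/-- The verdict cell c10 by its leading token (§0 VERDICT VOCABULARY of the census; map in the module docstring). `semiregClass` on a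
NON-SPLIT component would be a CANDIDATE; no row of record is one. [bookkeeping] -/
inductive Verdict
  | semiregClass | semiregClassDead | classOkNotSemireg | notSemireg | classDead
  | noObject | openOrUndecided | structural | calibration | pointer
  deriving DecidableEq, Repr

/-- One table row of CENSUS (g = 6) §2 (fields ↔ census columns: see the module docstring). [bookkeeping] -/
structure Row where
  /-- row id, census column c1 verbatim -/
  id : String
  /-- family letter(s) leading the id -/
  family : Family
  /-- row of the SIGNED pin v3.75 `9ce5a28eeae1edae` (218 rows); `false` only for the post-signing addendum row C14-16 -/
  signed : Bool
  /-- the level `n` (`g = 2n`) the row's statement is about; 3 = a g = 6 statement; 0 = several ∕ all levels -/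
  n : ℕ
  /-- non-split (deciding) ∕ split (method instance) ∕ every component ∕ none -/
  component : Component
  /-- member ∕ structure row ∕ calibration ∕ all-object barrier -/
  kind : Kind
  /-- CLASS half -/
  cls : ClassCell
  /-- SEMIREGULARITY half -/
  sigma : SigmaCell
  /-- verdict cell by leading token -/
  verdict : Verdict
  /-- c10 carries «SEMIREG+CLASS» ∕ «CANDIDATE» (numbers referee's regex of record; 38 rows as signed) -/
  scWord : Bool
  /-- c11 carries a bare «YES» token (numbers referee's rule of record; 9 rows as signed) -/
  yesToken : Bool
  deriving DecidableEq, Repr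

/-- **CENSUS (g = 6) §2 as kernel data**: the 219 table rows of `target-g6/CENSUS.md` v3.77 `5d64c8087faa95c9` in file order (§2.A
l.36–94, §2.B l.99–143, §2.C l.148–195, §2.D l.202–244, §2.L l.250–251, §2.K l.256–277), one `Row` each, cells transcribed as
documented in the module docstring and, cell by cell with the census excerpts, in `p11/CENSUS-G6-LEAN-MAP.tsv`. [bookkeeping;
transcription of the cell's census of record — the engines' numbers behind each cell are NOT recomputed here] -/
def census : List Row := [
  ⟨"A-0 (= engine-2 id Ke2-2)", .A, true, 3, .any, .calibration, .dead, .injective, .semiregClassDead, true, false⟩,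
  ⟨"A10-4a", .A, true, 3, .any, .member, .dead, .obstructed, .classDead, false, false⟩,
  ⟨"A10-4b", .A, true, 3, .any, .member, .dead, .obstructed, .classDead, false, false⟩,
  ⟨"A10-4c", .A, true, 3, .any, .member, .dead, .obstructed, .classDead, false, false⟩,
  ⟨"A9-0", .A, true, 3, .any, .structureRow, .dead, .injective, .semiregClassDead, true, false⟩,
  ⟨"A9-1·X2", .A, true, 3, .nonsplit, .member, .dead, .injective, .semiregClassDead, false, false⟩,
  ⟨"A9-1·X3", .A, true, 3, .nonsplit, .member, .dead, .injective, .semiregClassDead, false, false⟩,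
  ⟨"A9-1·X1", .A, true, 3, .split, .member, .dead, .injective, .semiregClassDead, false, false⟩,
  ⟨"A9-2·X2", .A, true, 3, .nonsplit, .member, .dead, .injective, .semiregClassDead, false, false⟩,
  ⟨"A9-2·X3", .A, true, 3, .nonsplit, .member, .dead, .injective, .semiregClassDead, false, false⟩,
  ⟨"A9-3·X2", .A, true, 3, .nonsplit, .member, .dead, .injective, .semiregClassDead, false, false⟩,
  ⟨"A9-3·X3", .A, true, 3, .nonsplit, .member, .dead, .injective, .semiregClassDead, false, false⟩,
  ⟨"A9-4·X2", .A, true, 3, .nonsplit, .member, .dead, .injective, .semiregClassDead, false, false⟩,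
  ⟨"A9-4·X3", .A, true, 3, .nonsplit, .member, .dead, .injective, .semiregClassDead, false, false⟩,
  ⟨"A9-4·X1", .A, true, 3, .split, .member, .dead, .injective, .semiregClassDead, false, false⟩,
  ⟨"A9-5·X2", .A, true, 3, .nonsplit, .member, .dead, .injective, .semiregClassDead, false, false⟩,
  ⟨"A9-5·X3", .A, true, 3, .nonsplit, .member, .dead, .injective, .semiregClassDead, false, false⟩,
  ⟨"A9-6·X2", .A, true, 3, .nonsplit, .member, .dead, .injective, .semiregClassDead, false, false⟩,
  ⟨"A9-6·X3", .A, true, 3, .nonsplit, .member, .dead, .injective, .semiregClassDead, false, false⟩,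
  ⟨"A9-7·X2", .A, true, 3, .nonsplit, .member, .dead, .injective, .semiregClassDead, false, false⟩,
  ⟨"A9-7·X3", .A, true, 3, .nonsplit, .member, .dead, .injective, .semiregClassDead, false, false⟩,
  ⟨"A9-8·X2", .A, true, 3, .nonsplit, .member, .dead, .injective, .semiregClassDead, false, false⟩,
  ⟨"A9-8·X3", .A, true, 3, .nonsplit, .member, .dead, .injective, .semiregClassDead, false, false⟩,
  ⟨"A9-9·X2", .A, true, 3, .nonsplit, .member, .dead, .injective, .semiregClassDead, false, false⟩,
  ⟨"A9-10·X2", .A, true, 3, .nonsplit, .member, .dead, .injective, .semiregClassDead, false, false⟩,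
  ⟨"A9-10·X3", .A, true, 3, .nonsplit, .member, .dead, .injective, .semiregClassDead, false, false⟩,
  ⟨"A9-11·X2", .A, true, 3, .nonsplit, .member, .dead, .injective, .semiregClassDead, false, false⟩,
  ⟨"A9-11·X3", .A, true, 3, .nonsplit, .member, .dead, .injective, .semiregClassDead, false, false⟩,
  ⟨"A9-11·X1", .A, true, 3, .split, .member, .dead, .injective, .semiregClassDead, false, false⟩,
  ⟨"A9-12·X2", .A, true, 3, .nonsplit, .member, .dead, .injective, .semiregClassDead, false, false⟩,
  ⟨"A9-12·X3", .A, true, 3, .nonsplit, .member, .dead, .injective, .semiregClassDead, false, false⟩,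
  ⟨"A9-13·X2", .A, true, 3, .nonsplit, .member, .dead, .obstructed, .classDead, false, false⟩,
  ⟨"A9-13·X3", .A, true, 3, .nonsplit, .member, .dead, .obstructed, .classDead, false, false⟩,
  ⟨"A9-14·X2", .A, true, 3, .nonsplit, .member, .dead, .injective, .semiregClassDead, false, false⟩,
  ⟨"A9-14·X3", .A, true, 3, .nonsplit, .member, .dead, .injective, .semiregClassDead, false, false⟩,
  ⟨"A9-14·X1", .A, true, 3, .split, .member, .dead, .injective, .semiregClassDead, false, false⟩,
  ⟨"A9-15·X2", .A, true, 3, .nonsplit, .member, .dead, .obstructed, .classDead, false, false⟩,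
  ⟨"A9-15·X3", .A, true, 3, .nonsplit, .member, .dead, .obstructed, .classDead, false, false⟩,
  ⟨"A9-16·X2", .A, true, 3, .nonsplit, .member, .dead, .obstructed, .classDead, false, false⟩,
  ⟨"A10-1", .A, true, 3, .nonsplit, .member, .dead, .injective, .semiregClassDead, false, false⟩,
  ⟨"A10-2", .A, true, 3, .nonsplit, .member, .dead, .injective, .semiregClassDead, false, false⟩,
  ⟨"A10-3", .A, true, 3, .nonsplit, .member, .dead, .injective, .semiregClassDead, false, false⟩,
  ⟨"A10-5", .A, true, 3, .nonsplit, .member, .dead, .injective, .semiregClassDead, false, false⟩,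
  ⟨"A10-6", .A, true, 3, .nonsplit, .structureRow, .none, .none, .pointer, false, false⟩,
  ⟨"A10-4d", .A, true, 3, .nonsplit, .member, .dead, .injective, .semiregClassDead, false, false⟩,
  ⟨"A10-7", .A, true, 3, .any, .structureRow, .dead, .none, .classDead, false, false⟩,
  ⟨"A10-8", .A, true, 3, .nonsplit, .structureRow, .dead, .none, .classDead, false, false⟩,
  ⟨"A25-1", .A, true, 3, .any, .structureRow, .none, .none, .structural, false, false⟩,
  ⟨"A25-2", .A, true, 3, .nonsplit, .structureRow, .none, .none, .openOrUndecided, true, false⟩,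
  ⟨"A10-9", .A, true, 3, .nonsplit, .structureRow, .dead, .none, .classDead, false, false⟩,
  ⟨"A9-17", .A, true, 3, .nonsplit, .structureRow, .ok, .none, .openOrUndecided, true, false⟩,
  ⟨"A25-3", .A, true, 3, .nonsplit, .structureRow, .ok, .none, .structural, true, false⟩,
  ⟨"A25-4", .A, true, 3, .nonsplit, .structureRow, .ok, .obstructed, .notSemireg, false, false⟩,
  ⟨"A25-5", .A, true, 3, .nonsplit, .structureRow, .ok, .undecided, .openOrUndecided, true, false⟩,
  ⟨"A25-6", .A, true, 3, .nonsplit, .structureRow, .ok, .none, .noObject, false, false⟩,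
  ⟨"A25-7", .A, true, 3, .nonsplit, .structureRow, .none, .obstructed, .notSemireg, false, false⟩,
  ⟨"A25-8", .A, true, 3, .nonsplit, .structureRow, .none, .obstructed, .notSemireg, false, false⟩,
  ⟨"A25-9", .A, true, 3, .nonsplit, .structureRow, .none, .obstructed, .notSemireg, false, false⟩,
  ⟨"A5-Δ", .A, true, 3, .nonsplit, .structureRow, .none, .none, .structural, false, false⟩,
  ⟨"B11-cal1", .B, true, 1, .none, .calibration, .none, .injective, .calibration, false, false⟩,
  ⟨"B11-cal2", .B, true, 2, .split, .calibration, .ok, .injective, .calibration, false, false⟩,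
  ⟨"B11-cal3", .B, true, 2, .split, .calibration, .none, .injective, .calibration, false, false⟩,
  ⟨"B11-cal4", .B, true, 2, .none, .calibration, .none, .injective, .calibration, false, false⟩,
  ⟨"B11-1", .B, true, 3, .any, .member, .dead, .injective, .semiregClassDead, false, false⟩,
  ⟨"B11-2", .B, true, 3, .none, .member, .dead, .none, .noObject, false, false⟩,
  ⟨"B11-3", .B, true, 3, .nonsplit, .member, .dead, .injective, .semiregClassDead, false, false⟩,
  ⟨"B11-4", .B, true, 3, .nonsplit, .member, .dead, .injective, .semiregClassDead, false, false⟩,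
  ⟨"B11-5", .B, true, 3, .nonsplit, .member, .dead, .obstructed, .classDead, false, false⟩,
  ⟨"B11-6", .B, true, 3, .nonsplit, .member, .undecided, .obstructed, .notSemireg, false, false⟩,
  ⟨"B11-7", .B, true, 3, .nonsplit, .member, .dead, .injective, .semiregClassDead, false, false⟩,
  ⟨"B11-8", .B, true, 3, .split, .calibration, .ok, .injective, .calibration, true, false⟩,
  ⟨"B11-9", .B, true, 3, .nonsplit, .member, .dead, .injective, .semiregClassDead, false, false⟩,
  ⟨"B11-10", .B, true, 3, .nonsplit, .member, .dead, .obstructed, .classDead, false, false⟩,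
  ⟨"B11-11", .B, true, 3, .nonsplit, .member, .ok, .obstructed, .classOkNotSemireg, false, false⟩,
  ⟨"B11-12", .B, true, 3, .nonsplit, .member, .dead, .injective, .semiregClassDead, false, false⟩,
  ⟨"B11-13", .B, true, 3, .none, .structureRow, .none, .none, .noObject, false, false⟩,
  ⟨"B11-14", .B, true, 3, .nonsplit, .structureRow, .dead, .injective, .classDead, false, false⟩,
  ⟨"B11-15", .B, true, 3, .nonsplit, .structureRow, .ok, .obstructed, .classOkNotSemireg, false, false⟩,
  ⟨"B11-16", .B, true, 3, .nonsplit, .structureRow, .ok, .undecided, .openOrUndecided, true, false⟩,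
  ⟨"B11-17", .B, true, 3, .nonsplit, .structureRow, .ok, .obstructed, .classOkNotSemireg, true, false⟩,
  ⟨"B12-1", .B, true, 3, .nonsplit, .structureRow, .none, .obstructed, .notSemireg, false, false⟩,
  ⟨"B12-2", .B, true, 3, .nonsplit, .structureRow, .dead, .none, .classDead, false, false⟩,
  ⟨"B12-3", .B, true, 3, .nonsplit, .structureRow, .dead, .none, .classDead, false, false⟩,
  ⟨"B12-4", .B, true, 3, .nonsplit, .member, .ok, .obstructed, .classOkNotSemireg, false, false⟩,
  ⟨"B12-5", .B, true, 3, .nonsplit, .member, .ok, .obstructed, .pointer, false, false⟩,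
  ⟨"B12-6", .B, true, 3, .nonsplit, .structureRow, .none, .none, .pointer, false, false⟩,
  ⟨"B12-6a", .B, true, 3, .nonsplit, .member, .ok, .obstructed, .classOkNotSemireg, false, false⟩,
  ⟨"B12-6b", .B, true, 3, .nonsplit, .member, .ok, .obstructed, .classOkNotSemireg, false, false⟩,
  ⟨"B12-6c", .B, true, 3, .nonsplit, .member, .ok, .obstructed, .classOkNotSemireg, false, false⟩,
  ⟨"B12-6d", .B, true, 3, .nonsplit, .member, .ok, .obstructed, .classOkNotSemireg, false, false⟩,
  ⟨"B12-7", .B, true, 3, .nonsplit, .member, .ok, .obstructed, .classOkNotSemireg, false, false⟩,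
  ⟨"B12-8", .B, true, 3, .nonsplit, .member, .ok, .obstructed, .classOkNotSemireg, false, false⟩,
  ⟨"B12-9", .B, true, 3, .nonsplit, .member, .ok, .undecided, .openOrUndecided, true, true⟩,
  ⟨"B12-9b", .B, true, 3, .nonsplit, .member, .ok, .undecided, .openOrUndecided, true, true⟩,
  ⟨"B12-9c", .B, true, 3, .nonsplit, .member, .ok, .undecided, .openOrUndecided, false, true⟩,
  ⟨"B12-10", .B, true, 3, .nonsplit, .member, .ok, .undecided, .openOrUndecided, false, true⟩,
  ⟨"B12-11a", .B, true, 3, .nonsplit, .member, .ok, .undecided, .openOrUndecided, false, false⟩,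
  ⟨"B12-11b", .B, true, 3, .nonsplit, .member, .ok, .obstructed, .classOkNotSemireg, false, false⟩,
  ⟨"B12-12a", .B, true, 3, .nonsplit, .member, .ok, .undecided, .openOrUndecided, false, false⟩,
  ⟨"B12-12b", .B, true, 3, .nonsplit, .member, .ok, .obstructed, .classOkNotSemireg, false, false⟩,
  ⟨"B12-13", .B, true, 3, .nonsplit, .member, .ok, .undecided, .openOrUndecided, false, false⟩,
  ⟨"B12-14", .B, true, 3, .nonsplit, .structureRow, .ok, .undecided, .structural, false, true⟩,
  ⟨"B12-15", .B, true, 3, .nonsplit, .structureRow, .ok, .undecided, .openOrUndecided, false, false⟩,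
  ⟨"B12-16", .B, true, 3, .nonsplit, .structureRow, .ok, .undecided, .openOrUndecided, false, false⟩,
  ⟨"C13-1", .C, true, 3, .none, .member, .dead, .injective, .semiregClassDead, false, false⟩,
  ⟨"C13-2", .C, true, 3, .none, .member, .dead, .obstructed, .classDead, false, false⟩,
  ⟨"C13-3", .C, true, 3, .none, .member, .dead, .injective, .semiregClassDead, false, false⟩,
  ⟨"C13-4", .C, true, 3, .none, .member, .dead, .injective, .semiregClassDead, false, false⟩,
  ⟨"C13-5", .C, true, 3, .split, .member, .ok, .obstructed, .classOkNotSemireg, false, false⟩,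
  ⟨"C13-6", .C, true, 3, .none, .structureRow, .dead, .obstructed, .classDead, false, false⟩,
  ⟨"C13-7", .C, true, 3, .split, .member, .ok, .obstructed, .classOkNotSemireg, false, false⟩,
  ⟨"C13-8", .C, true, 3, .split, .member, .ok, .injective, .semiregClass, false, false⟩,
  ⟨"C13-9", .C, true, 3, .split, .structureRow, .none, .none, .structural, false, false⟩,
  ⟨"C13-10", .C, true, 3, .split, .member, .ok, .injective, .semiregClass, false, false⟩,
  ⟨"C13-11", .C, true, 3, .split, .member, .dead, .obstructed, .notSemireg, false, false⟩,
  ⟨"C13-12", .C, true, 3, .split, .member, .ok, .injective, .semiregClass, false, false⟩,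
  ⟨"C13-13", .C, true, 3, .split, .member, .ok, .injective, .semiregClass, false, false⟩,
  ⟨"C13-14", .C, true, 0, .split, .structureRow, .none, .none, .structural, false, false⟩,
  ⟨"C13-15", .C, true, 3, .split, .member, .dead, .injective, .classDead, false, false⟩,
  ⟨"C13-16", .C, true, 3, .split, .member, .ok, .injective, .semiregClass, false, false⟩,
  ⟨"C13-17", .C, true, 3, .any, .structureRow, .dead, .none, .classDead, false, false⟩,
  ⟨"C13-18", .C, true, 3, .any, .structureRow, .ok, .none, .structural, false, false⟩,
  ⟨"C13-19", .C, true, 3, .any, .structureRow, .dead, .none, .classDead, false, false⟩,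
  ⟨"C13-20", .C, true, 3, .nonsplit, .member, .ok, .obstructed, .notSemireg, false, false⟩,
  ⟨"C13-21", .C, true, 3, .nonsplit, .structureRow, .ok, .obstructed, .notSemireg, false, false⟩,
  ⟨"C13-22", .C, true, 3, .nonsplit, .structureRow, .dead, .none, .structural, false, false⟩,
  ⟨"C13-23", .C, true, 3, .nonsplit, .structureRow, .dead, .none, .structural, false, false⟩,
  ⟨"C13-24", .C, true, 3, .nonsplit, .structureRow, .dead, .none, .structural, false, false⟩,
  ⟨"C13-25", .C, true, 0, .nonsplit, .structureRow, .dead, .none, .structural, true, false⟩,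
  ⟨"C13-26", .C, true, 3, .nonsplit, .structureRow, .dead, .none, .structural, true, false⟩,
  ⟨"C14-0", .C, true, 3, .split, .structureRow, .none, .none, .structural, false, false⟩,
  ⟨"C14-1", .C, true, 3, .split, .member, .ok, .obstructed, .classOkNotSemireg, false, false⟩,
  ⟨"C14-2", .C, true, 3, .split, .member, .ok, .obstructed, .classOkNotSemireg, false, false⟩,
  ⟨"C14-3", .C, true, 3, .split, .member, .ok, .injective, .semiregClass, true, false⟩,
  ⟨"C14-4", .C, true, 3, .split, .member, .ok, .obstructed, .classOkNotSemireg, false, false⟩,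
  ⟨"C14-5", .C, true, 3, .split, .structureRow, .ok, .injective, .semiregClass, true, false⟩,
  ⟨"C14-6", .C, true, 3, .none, .member, .dead, .obstructed, .classDead, false, false⟩,
  ⟨"C14-7", .C, true, 3, .split, .member, .ok, .obstructed, .classOkNotSemireg, false, false⟩,
  ⟨"C14-8", .C, true, 3, .split, .member, .ok, .injective, .semiregClass, true, false⟩,
  ⟨"C14-9", .C, true, 0, .split, .structureRow, .none, .none, .structural, false, false⟩,
  ⟨"C14-10", .C, true, 3, .split, .member, .ok, .obstructed, .classOkNotSemireg, false, false⟩,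
  ⟨"C14-11", .C, true, 3, .split, .member, .ok, .injective, .semiregClass, true, false⟩,
  ⟨"C14-12", .C, true, 3, .split, .member, .ok, .injective, .semiregClass, true, false⟩,
  ⟨"C14-13", .C, true, 0, .any, .structureRow, .ok, .obstructed, .structural, false, false⟩,
  ⟨"C14-14", .C, true, 3, .nonsplit, .structureRow, .ok, .none, .structural, false, false⟩,
  ⟨"C14-15", .C, true, 3, .nonsplit, .structureRow, .dead, .none, .structural, true, true⟩,
  ⟨"C14-16", .C, false, 3, .nonsplit, .structureRow, .dead, .none, .structural, false, false⟩,
  ⟨"C15-1", .C, true, 3, .nonsplit, .member, .dead, .injective, .semiregClassDead, false, false⟩,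
  ⟨"C15-2", .C, true, 3, .split, .member, .ok, .obstructed, .classOkNotSemireg, false, false⟩,
  ⟨"C15-3", .C, true, 3, .split, .member, .ok, .obstructed, .classOkNotSemireg, false, false⟩,
  ⟨"C15-4", .C, true, 3, .split, .member, .ok, .obstructed, .classOkNotSemireg, false, false⟩,
  ⟨"C15-5", .C, true, 3, .split, .member, .ok, .obstructed, .classOkNotSemireg, false, false⟩,
  ⟨"D-1", .D, true, 3, .split, .member, .ok, .injective, .semiregClass, true, false⟩,
  ⟨"D-2", .D, true, 3, .split, .member, .ok, .injective, .semiregClass, true, false⟩,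
  ⟨"D-3", .D, true, 3, .split, .member, .ok, .injective, .semiregClass, true, false⟩,
  ⟨"D-4", .D, true, 3, .split, .member, .ok, .injective, .semiregClass, true, false⟩,
  ⟨"D-5", .D, true, 3, .split, .member, .ok, .injective, .semiregClass, true, false⟩,
  ⟨"D-6", .D, true, 3, .split, .member, .ok, .injective, .semiregClass, true, false⟩,
  ⟨"D-7", .D, true, 3, .split, .structureRow, .ok, .none, .noObject, false, false⟩,
  ⟨"D-8", .D, true, 3, .nonsplit, .member, .dead, .injective, .semiregClassDead, false, false⟩,
  ⟨"D-9", .D, true, 3, .nonsplit, .member, .dead, .injective, .semiregClassDead, false, false⟩,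
  ⟨"D-10", .D, true, 3, .nonsplit, .member, .undecided, .obstructed, .notSemireg, false, false⟩,
  ⟨"D-11", .D, true, 3, .nonsplit, .member, .dead, .obstructed, .classDead, true, false⟩,
  ⟨"D-11b", .D, true, 3, .nonsplit, .member, .dead, .obstructed, .classDead, true, false⟩,
  ⟨"D-11c", .D, true, 3, .nonsplit, .member, .dead, .injective, .semiregClassDead, true, false⟩,
  ⟨"D-12", .D, true, 3, .nonsplit, .member, .dead, .none, .classDead, false, false⟩,
  ⟨"D-13", .D, true, 3, .nonsplit, .structureRow, .ok, .none, .noObject, true, false⟩,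
  ⟨"D-14", .D, true, 3, .nonsplit, .structureRow, .undecided, .none, .openOrUndecided, true, false⟩,
  ⟨"D-14b", .D, true, 3, .nonsplit, .structureRow, .dead, .none, .structural, true, false⟩,
  ⟨"D-15", .D, true, 3, .nonsplit, .structureRow, .dead, .none, .classDead, true, false⟩,
  ⟨"D-16", .D, true, 3, .nonsplit, .member, .ok, .undecided, .openOrUndecided, false, false⟩,
  ⟨"D-17", .D, true, 3, .nonsplit, .member, .ok, .obstructed, .classOkNotSemireg, false, false⟩,
  ⟨"D-18", .D, true, 3, .nonsplit, .member, .ok, .obstructed, .noObject, false, false⟩,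
  ⟨"D-19", .D, true, 3, .nonsplit, .structureRow, .dead, .obstructed, .classDead, false, false⟩,
  ⟨"D-20", .D, true, 3, .nonsplit, .member, .undecided, .undecided, .openOrUndecided, false, false⟩,
  ⟨"D-21", .D, true, 3, .nonsplit, .structureRow, .none, .none, .noObject, false, false⟩,
  ⟨"D-22", .D, true, 3, .nonsplit, .structureRow, .none, .obstructed, .notSemireg, false, false⟩,
  ⟨"D-23", .D, true, 3, .nonsplit, .structureRow, .none, .obstructed, .notSemireg, false, false⟩,
  ⟨"D-24", .D, true, 3, .nonsplit, .member, .dead, .injective, .classDead, false, false⟩,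
  ⟨"D-25", .D, true, 3, .split, .member, .ok, .obstructed, .notSemireg, false, false⟩,
  ⟨"D-26", .D, true, 3, .split, .member, .ok, .undecided, .openOrUndecided, false, false⟩,
  ⟨"D-27", .D, true, 3, .nonsplit, .calibration, .dead, .injective, .classDead, false, false⟩,
  ⟨"D-L1", .DL, true, 4, .split, .member, .ok, .obstructed, .classOkNotSemireg, false, false⟩,
  ⟨"D-L2", .DL, true, 0, .split, .member, .dead, .none, .classDead, false, false⟩,
  ⟨"D-L3", .DL, true, 4, .split, .structureRow, .none, .obstructed, .notSemireg, false, false⟩,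
  ⟨"D-L4", .DL, true, 5, .split, .member, .ok, .undecided, .openOrUndecided, false, false⟩,
  ⟨"D-28", .D, true, 0, .any, .structureRow, .none, .obstructed, .notSemireg, false, false⟩,
  ⟨"De2-R3-1", .D, true, 3, .nonsplit, .structureRow, .undecided, .none, .openOrUndecided, false, false⟩,
  ⟨"D-29", .D, true, 3, .nonsplit, .member, .ok, .obstructed, .notSemireg, true, true⟩,
  ⟨"D-29b", .D, true, 3, .nonsplit, .structureRow, .none, .none, .structural, true, true⟩,
  ⟨"D-29c", .D, true, 3, .nonsplit, .structureRow, .none, .none, .structural, false, true⟩,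
  ⟨"D-30", .D, true, 0, .any, .structureRow, .none, .none, .structural, false, false⟩,
  ⟨"D-31", .D, true, 3, .nonsplit, .structureRow, .dead, .none, .classDead, false, false⟩,
  ⟨"D-32", .D, true, 6, .split, .member, .ok, .obstructed, .notSemireg, false, false⟩,
  ⟨"D-33", .D, true, 6, .split, .member, .ok, .obstructed, .notSemireg, false, false⟩,
  ⟨"L-1", .L, true, 3, .nonsplit, .structureRow, .dead, .none, .structural, true, false⟩,
  ⟨"L-2", .L, true, 3, .nonsplit, .structureRow, .dead, .none, .structural, true, false⟩,
  ⟨"K-0a", .K, true, 2, .split, .calibration, .ok, .injective, .semiregClass, true, false⟩,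
  ⟨"K-0b", .K, true, 1, .none, .calibration, .none, .none, .calibration, false, false⟩,
  ⟨"K-2", .K, true, 3, .none, .calibration, .none, .injective, .calibration, false, false⟩,
  ⟨"K-3", .K, true, 3, .none, .calibration, .none, .injective, .calibration, false, false⟩,
  ⟨"K-5", .K, true, 3, .none, .calibration, .none, .obstructed, .calibration, false, false⟩,
  ⟨"K-6", .K, true, 3, .none, .calibration, .none, .obstructed, .calibration, false, false⟩,
  ⟨"K-7", .K, true, 3, .none, .calibration, .none, .obstructed, .calibration, false, false⟩,
  ⟨"K-8", .K, true, 3, .none, .calibration, .none, .injective, .calibration, false, false⟩,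
  ⟨"K-9", .K, true, 3, .split, .calibration, .none, .none, .calibration, false, false⟩,
  ⟨"K-10", .K, true, 0, .split, .calibration, .dead, .injective, .calibration, false, false⟩,
  ⟨"K-11", .K, true, 0, .none, .calibration, .none, .none, .calibration, true, false⟩,
  ⟨"K-A-1", .K, true, 1, .none, .calibration, .none, .injective, .calibration, false, false⟩,
  ⟨"K-A-2 (= Ke2-1)", .K, true, 2, .none, .calibration, .dead, .injective, .calibration, false, false⟩,
  ⟨"K-A-4 (= Ke2-3)", .K, true, 4, .none, .calibration, .dead, .injective, .calibration, false, false⟩,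
  ⟨"K-C13-1", .K, true, 1, .none, .calibration, .none, .injective, .calibration, false, false⟩,
  ⟨"K-C13-2", .K, true, 2, .split, .calibration, .ok, .injective, .calibration, false, false⟩,
  ⟨"K-A9-1", .K, true, 1, .none, .calibration, .dead, .injective, .calibration, false, false⟩,
  ⟨"K-A9-2", .K, true, 2, .none, .calibration, .dead, .injective, .calibration, false, false⟩,
  ⟨"K-A10-1", .K, true, 2, .none, .calibration, .dead, .injective, .calibration, false, false⟩,
  ⟨"K-A10-2", .K, true, 1, .none, .calibration, .none, .injective, .calibration, false, false⟩,
  ⟨"K-C14-1", .K, true, 1, .none, .calibration, .none, .obstructed, .calibration, false, false⟩,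
  ⟨"K-C14-2", .K, true, 2, .none, .calibration, .none, .injective, .calibration, false, false⟩]

end Summit.Ventures.HSemireg.CensusG6
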